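import Summits.QuantumFields.YangMills.Theorems.SmallCircleAnchorAnchorGapPeelRegroup
import Summits.QuantumFields.YangMills.Theorems.SmallCircleAnchorAnchorGapAtomPeelResummation

/-!
# Crux `AnchorGap` (stmt-QuantumFields-11141), line `registered` — STUB GREP: the Gaussian
# Battle–Brydges–Federbush polymer representation (`stub_gaussianBBFPolymerRep`, GENERIC; L)

The statement is the registered stub's text (`Cruxes/AnchorGap/Lines/birth.lean` :204–205, skeleton
9092be15) token for token.  PROOF = the assembly (LOCATE-GREP v2, evidence #29 on 11141):
✓PEEL applied to `σ ↦ E(cov X σ)(Π_{b∈X} G b)` and every term identified (✓(G5b)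
`Peel.peel_gaussExpect_prod`: ✓(G1c) smooth domain, ✓(G2d) iterated line derivatives = `Dop`-iterates,
✓(G5c) vanishing off `X`), regrouped by point set with px5 g17's ✓(G5-loc)∕✓(G5-marg) and ✓(G3)
(✓(G5e) `Regroup.peeled_recursion`, `bracket_singleton`, `gaussExpect_empty_one`, `cov_univ_one`), and
resummed into the hard-core polymer gas by ✓(G5f-alg) `Resum.eq_prod_mul_polymerPartitionFunction`
(strong induction on the atom set against ✓(G4) `AtomGas.polymerPartitionFunction_atom_recursion`),
with the root transport `min Y = min X` for `min X ∈ Y ⊆ X` and the `ℝ → ℂ` casts.  Landed as a HELPER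
(`--supports`): the ledger's registered GREP signature is truncated at the first `:=` inside its `let`s
(evidence #27), so stub mode cannot match it until the registry is repaired.
[cite: Brydges1986, §3; Mastropietro2008, §2.8 (2.91)-(2.98)]; no definition, no named fact.
-/

set_option autoImplicit false

namespace Summit.QuantumFields.YangMills.Theorems.AnchorGap

open MeasureTheory Finset Literature.Probability.LatticeModels
  Literature.Probability.LatticeModels.BattleFederbush Literature.MeasureTheory.Integral MvPolynomial
open scoped Matrix

/-- **Stub GREP (GENERIC; L — the Gaussian Battle–Brydges–Federbush polymer representation), the
registered text.** For a positive definite covariance `C` on sites `ι` grouped into atoms by `blk`, smooth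
atom-local observables `G_b` with all derivatives of polynomial growth and non-vanishing one-atom partition
functions `Z1 b`, the normalised full Gaussian expectation `E_C(Π_b G_b) / Π_b Z1 b` equals the hard-core
(overlap) polymer partition function over the atom sets of size `≥ 2` with the explicit script activities
`K X` (sum over valid scripts rooted at `min X` with point set `X` of the cube integral of the script weight
times the interpolated expectation, at the decoupled point, of the line-differentiated product, normalised by
`Π_{b∈X} Z1 b`).  Proof: ✓(G5e) `Regroup.peeled_recursion` + `bracket_singleton` + `gaussExpect_empty_one`
+ `cov_univ_one` fed to ✓(G5f-alg) `Resum.eq_prod_mul_polymerPartitionFunction` at `X = univ`.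
[cite: Brydges1986, §3; Mastropietro2008, §2.8 (2.91)-(2.98)] -/
theorem stub_gaussianBBFPolymerRep :
    ∀ (ι β : Type) [Fintype ι] [DecidableEq ι] [Fintype β] [DecidableEq β] [LinearOrder β] (blk : ι → β) (C : Matrix ι ι ℝ), C.PosDef → ∀ (G : β → (ι → ℝ) → ℝ), (∀ b : β, ContDiff ℝ (⊤ : ℕ∞) (G b)) → (∀ (b : β) (n : ℕ), ∃ (K : ℝ) (m : ℕ), ∀ φ : ι → ℝ, ‖iteratedFDeriv ℝ n (G b) φ‖ ≤ K * (1 + ∑ i, φ i ^ 2) ^ m) → (∀ (b : β) (φ ψ : ι → ℝ), (∀ i : ι, blk i = b → φ i = ψ i) → G b φ = G b ψ) → let cov : Finset β → (Sym2 β → ℝ) → Matrix ι ι ℝ := fun X σ => Matrix.of fun i j : ι => (if blk i = blk j then 1 else if blk i ∈ X ∧ blk j ∈ X then σ s(blk i, blk j) else 0) * C i j; let E : Matrix ι ι ℝ → ((ι → ℝ) → ℝ) → ℝ := fun Cv H => (∫ φ : ι → ℝ, H φ * Real.exp (-(φ ⬝ᵥ (Cv⁻¹ *ᵥ φ)) /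 2)) / ∫ φ : ι → ℝ, Real.exp (-(φ ⬝ᵥ (Cv⁻¹ *ᵥ φ)) / 2); let Dop : Sym2 β → ((ι → ℝ) → ℝ) → ((ι → ℝ) → ℝ) := fun ℓ H φ => (1 / 2 : ℝ) * ∑ x : ι, ∑ y : ι, if s(blk x, blk y) = ℓ ∧ blk x ≠ blk y then C x y * iteratedFDeriv ℝ 2 H φ ![Pi.single x 1, Pi.single y 1] else 0; let Z1 : β → ℝ := fun b => E (cov ∅ fun _ => 0) (G b); (∀ b : β, Z1 b ≠ 0) → let K : Finset β → ℝ := fun X => if hX : 2 ≤ X.card then (∑ k ∈ Finset.range (Fintype.card β), ∑ s : BattleFederbush.Script (X.min' (Finset.card_pos.mp (lt_of_lt_of_le Nat.zero_lt_two hX))) k, if s.Valid ∧ Finset.univ.image s.y = X then ∫ t in Literature.MeasureTheory.Integral.unitCube β, MvPolynomial.eval t (BattleFederbush.Script.weight ℝ s) * E (cov X fun ℓ => MvPolynomial.eval t (BattleFederbush.Script.decPt ℝ s ℓ)) (s.lines.foldl (fun H ℓ => Dop ℓ H) fun φ => ∏ b ∈ X, G b φ) else 0) / ∏ b ∈ X,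 Z1 b else 0; ((E C (fun φ => ∏ b : β, G b φ) / ∏ b : β, Z1 b : ℝ) : ℂ) = polymerPartitionFunction polyInc (fun X : Finset β => (K X : ℂ)) (Finset.univ.powerset.filter fun X : Finset β => 2 ≤ X.card) := by
  intro ι β _ _ _ _ _ blk C hC G hG hGb hGl
  dsimp only
  intro hZ1
  classical
  have hz1 : ∀ b : β, ((((∫ φ : ι → ℝ, G b φ * Real.exp (-(φ ⬝ᵥ ((Matrix.of fun i j : ι => (if blk i = blk j then 1 else if blk i ∈ (∅ : Finset β) ∧ blk j ∈ (∅ : Finset β) then (0 : ℝ) else 0) * C i j)⁻¹ *ᵥ φ)) / 2))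
        / ∫ φ : ι → ℝ, Real.exp (-(φ ⬝ᵥ ((Matrix.of fun i j : ι => (if blk i = blk j then 1 else if blk i ∈ (∅ : Finset β) ∧ blk j ∈ (∅ : Finset β) then (0 : ℝ) else 0) * C i j)⁻¹ *ᵥ φ)) / 2)) : ℝ) : ℂ) ≠ 0 :=
    fun b => Complex.ofReal_ne_zero.2 (hZ1 b)
  have main := Resum.eq_prod_mul_polymerPartitionFunction
    (fun X : Finset β => ((((∫ φ : ι → ℝ, (∏ b ∈ X, G b φ) * Real.exp (-(φ ⬝ᵥ ((Matrix.of fun i j : ι => (if blk i = blk j then 1 else if blk i ∈ X ∧ blk j ∈ X then (1 : ℝ) else 0) * C i j)⁻¹ *ᵥ φ)) / 2))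
        / ∫ φ : ι → ℝ, Real.exp (-(φ ⬝ᵥ ((Matrix.of fun i j : ι => (if blk i = blk j then 1 else if blk i ∈ X ∧ blk j ∈ X then (1 : ℝ) else 0) * C i j)⁻¹ *ᵥ φ)) / 2)) : ℝ) : ℂ))
    (fun Y : Finset β => if hY : Y.Nonempty then
      (((∑ k ∈ Finset.range (Fintype.card β), ∑ s : Script (Y.min' hY) k,
        if s.Valid ∧ Finset.univ.image s.y = Y then
          ∫ t in unitCube β, eval t (Script.weight ℝ s) *
            ((∫ φ : ι → ℝ, (s.lines.foldl (fun (K : (ι → ℝ) → ℝ) (ℓ : Sym2 β) => fun φ : ι → ℝ =>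
            (1 / 2 : ℝ) * ∑ x : ι, ∑ y : ι, if s(blk x, blk y) = ℓ ∧ blk x ≠ blk y
              then C x y * iteratedFDeriv ℝ 2 K φ ![Pi.single x 1, Pi.single y 1] else 0)
            (fun φ : ι → ℝ => ∏ b ∈ Y, G b φ)) φ * Real.exp (-(φ ⬝ᵥ ((Matrix.of fun i j : ι => (if blk i = blk j then 1 else if blk i ∈ Y ∧ blk j ∈ Y then eval t (Script.decPt ℝ s s(blk i, blk j)) else 0) * C i j)⁻¹ *ᵥ φ)) / 2))
              / ∫ φ : ι → ℝ, Real.exp (-(φ ⬝ᵥ ((Matrix.of fun i j : ι => (if blk i = blk j then 1 else if blk i ∈ Y ∧ blk j ∈ Y then eval t (Script.decPt ℝ s s(blk i, blk j)) else 0) * C i j)⁻¹ *ᵥ φ)) / 2))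
        else 0) : ℝ) : ℂ) else 0)
    (fun b : β => ((((∫ φ : ι → ℝ, G b φ * Real.exp (-(φ ⬝ᵥ ((Matrix.of fun i j : ι => (if blk i = blk j then 1 else if blk i ∈ (∅ : Finset β) ∧ blk j ∈ (∅ : Finset β) then (0 : ℝ) else 0) * C i j)⁻¹ *ᵥ φ)) / 2))
        / ∫ φ : ι → ℝ, Real.exp (-(φ ⬝ᵥ ((Matrix.of fun i j : ι => (if blk i = blk j then 1 else if blk i ∈ (∅ : Finset β) ∧ blk j ∈ (∅ : Finset β) then (0 : ℝ) else 0) * C i j)⁻¹ *ᵥ φ)) / 2)) : ℝ) : ℂ))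
    hz1 ?_ ?_ ?_ Finset.univ
  rotate_left
  · -- `Z ∅ = 1`
    exact_mod_cast Regroup.gaussExpect_empty_one blk C hC G
  · -- the singleton bracket is `Z1`
    intro a
    rw [dif_pos (Finset.singleton_nonempty a)]
    have key : ∀ r : β, a = r →
        (((∑ k ∈ Finset.range (Fintype.card β), ∑ s : Script (r) k,
            if s.Valid ∧ Finset.univ.image s.y = ({a} : Finset β) then
              ∫ t in unitCube β, eval t (Script.weight ℝ s) *
                ((∫ φ : ι → ℝ, (s.lines.foldl (fun (K : (ι → ℝ) → ℝ) (ℓ : Sym2 β) => fun φ : ι → ℝ =>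
            (1 / 2 : ℝ) * ∑ x : ι, ∑ y : ι, if s(blk x, blk y) = ℓ ∧ blk x ≠ blk y
              then C x y * iteratedFDeriv ℝ 2 K φ ![Pi.single x 1, Pi.single y 1] else 0)
            (fun φ : ι → ℝ => ∏ b ∈ ({a} : Finset β), G b φ)) φ * Real.exp (-(φ ⬝ᵥ ((Matrix.of fun i j : ι => (if blk i = blk j then 1 else if blk i ∈ ({a} : Finset β) ∧ blk j ∈ ({a} : Finset β) then eval t (Script.decPt ℝ s s(blk i, blk j)) else 0) * C i j)⁻¹ *ᵥ φ)) / 2))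
                  / ∫ φ : ι → ℝ, Real.exp (-(φ ⬝ᵥ ((Matrix.of fun i j : ι => (if blk i = blk j then 1 else if blk i ∈ ({a} : Finset β) ∧ blk j ∈ ({a} : Finset β) then eval t (Script.decPt ℝ s s(blk i, blk j)) else 0) * C i j)⁻¹ *ᵥ φ)) / 2))
            else 0) : ℝ) : ℂ)
          = ((((∫ φ : ι → ℝ, G a φ * Real.exp (-(φ ⬝ᵥ ((Matrix.of fun i j : ι => (if blk i = blk j then 1 else if blk i ∈ (∅ : Finset β) ∧ blk j ∈ (∅ : Finset β) then (0 : ℝ) else 0) * C i j)⁻¹ *ᵥ φ)) / 2))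
              / ∫ φ : ι → ℝ, Real.exp (-(φ ⬝ᵥ ((Matrix.of fun i j : ι => (if blk i = blk j then 1 else if blk i ∈ (∅ : Finset β) ∧ blk j ∈ (∅ : Finset β) then (0 : ℝ) else 0) * C i j)⁻¹ *ᵥ φ)) / 2)) : ℝ) : ℂ) := by
      intro r hr
      subst hr
      exact_mod_cast Regroup.bracket_singleton blk C G a
    exact key _ (Finset.min'_singleton a).symm
  · -- the atom-peeled recursion
    intro X hX
    rw [Regroup.peeled_recursion blk C hC G hG hGb hGl X (Finset.min'_mem X hX), Complex.ofReal_sum]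
    refine Finset.sum_congr rfl fun Y hY => ?_
    have hrY : X.min' hX ∈ Y := (Finset.mem_filter.1 hY).2
    have hYX : Y ⊆ X := Finset.mem_powerset.1 (Finset.mem_filter.1 hY).1
    have hYne : Y.Nonempty := ⟨_, hrY⟩
    rw [dif_pos hYne, Complex.ofReal_mul]
    have e : Y.min' hYne = X.min' hX :=
      le_antisymm (Finset.min'_le Y _ hrY) (Finset.min'_le X _ (hYX (Finset.min'_mem Y hYne)))
    have key : ∀ r r' : β, r = r' →
        (((∑ k ∈ Finset.range (Fintype.card β), ∑ s : Script (r) k,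
            if s.Valid ∧ Finset.univ.image s.y = Y then
              ∫ t in unitCube β, eval t (Script.weight ℝ s) *
                ((∫ φ : ι → ℝ, (s.lines.foldl (fun (K : (ι → ℝ) → ℝ) (ℓ : Sym2 β) => fun φ : ι → ℝ =>
            (1 / 2 : ℝ) * ∑ x : ι, ∑ y : ι, if s(blk x, blk y) = ℓ ∧ blk x ≠ blk y
              then C x y * iteratedFDeriv ℝ 2 K φ ![Pi.single x 1, Pi.single y 1] else 0)
            (fun φ : ι → ℝ => ∏ b ∈ Y, G b φ)) φ * Real.exp (-(φ ⬝ᵥ ((Matrix.of fun i j : ι => (if blk i = blk j then 1 else if blk i ∈ Y ∧ blk j ∈ Y then eval t (Script.decPt ℝ s s(blk i, blk j)) else 0) * C i j)⁻¹ *ᵥ φ)) / 2))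
                  / ∫ φ : ι → ℝ, Real.exp (-(φ ⬝ᵥ ((Matrix.of fun i j : ι => (if blk i = blk j then 1 else if blk i ∈ Y ∧ blk j ∈ Y then eval t (Script.decPt ℝ s s(blk i, blk j)) else 0) * C i j)⁻¹ *ᵥ φ)) / 2))
            else 0) : ℝ) : ℂ)
          = (((∑ k ∈ Finset.range (Fintype.card β), ∑ s : Script (r') k,
            if s.Valid ∧ Finset.univ.image s.y = Y then
              ∫ t in unitCube β, eval t (Script.weight ℝ s) *
                ((∫ φ : ι → ℝ, (s.lines.foldl (fun (K : (ι → ℝ) → ℝ) (ℓ : Sym2 β) => fun φ : ι → ℝ =>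
            (1 / 2 : ℝ) * ∑ x : ι, ∑ y : ι, if s(blk x, blk y) = ℓ ∧ blk x ≠ blk y
              then C x y * iteratedFDeriv ℝ 2 K φ ![Pi.single x 1, Pi.single y 1] else 0)
            (fun φ : ι → ℝ => ∏ b ∈ Y, G b φ)) φ * Real.exp (-(φ ⬝ᵥ ((Matrix.of fun i j : ι => (if blk i = blk j then 1 else if blk i ∈ Y ∧ blk j ∈ Y then eval t (Script.decPt ℝ s s(blk i, blk j)) else 0) * C i j)⁻¹ *ᵥ φ)) / 2))
                  / ∫ φ : ι → ℝ, Real.exp (-(φ ⬝ᵥ ((Matrix.of fun i j : ι => (if blk i = blk j then 1 else if blk i ∈ Y ∧ blk j ∈ Y then eval t (Script.decPt ℝ s s(blk i, blk j)) else 0) * C i j)⁻¹ *ᵥ φ)) / 2))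
            else 0) : ℝ) : ℂ) := by
      rintro r _ rfl; rfl
    rw [key _ _ e]
  -- conclusion at `X = univ`
  beta_reduce at main
  rw [Regroup.cov_univ_one blk C] at main
  rw [Complex.ofReal_div, Complex.ofReal_prod, main,
    mul_div_cancel_left₀ _ (Finset.prod_ne_zero_iff.2 fun b _ => hz1 b)]
  refine polymerPartitionFunction_congr fun Y hY => ?_
  have h2 : 2 ≤ Y.card := (Finset.mem_filter.1 hY).2
  have hYne : Y.Nonempty := Finset.card_pos.mp (lt_of_lt_of_le Nat.zero_lt_two h2)
  rw [dif_pos hYne, dif_pos h2, Complex.ofReal_div, Complex.ofReal_prod]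

end Summit.QuantumFields.YangMills.Theorems.AnchorGap
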